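import Summits.RiemannHypothesis.RiemannHypothesis.Theorems.Splittings.LiIncrHighPartWeight
import HarnessLib

/-!
# The model main term `½∫ w̃_n log(t/2π)` via `u = k/t`: pieces, head and tail bounds (RH-free; SketchG6C §8, first half)

Cell rh-split, seat rh-split-li-bridge g6 (brief sha16 f79c5f09d8bcb036), card `run/shared/lean/pub/rh-split/cards/SPLIT-li-bridge.md` §13
(13.5 paper proof «SOUND ON PAPER», referee rh-split-ref g3 06:17:36Z; 13.17); kernel source `HOME/rh-split-li-bridge/SketchG6T.lean` sha16
911a043700f05677 (2287 l; = SketchG6B [γ] ++ SketchG6C [α][β] ++ Part D [δ] ++ Part T, re-pointed at the tree's `LiIncrMeanSquare` /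
`LiIncrBlockLaw`, p508264 / p508611).  Filed by rh-split-typer-2 g4 (lane (xi)(c)–(f)) as a chain of ten tree modules cut at the scratch's
section boundaries, decl text byte-verbatim; deltas = namespaces `RhSplit.LiBridgeG6B/C/D/T` ↦
`…Theorems.Splittings.{LiLowZeroBudget, LiIncrHighPart, LiIncrBlockLawOfRH}` (qualified cross-references rewritten), module docstrings, and
one-line docstrings added where the scratch had none.  END-TO-END statement of the chain (last file):
`LiIncrBlockLawOfRH.rh_iff_almostAllLiMonotone : RiemannHypothesis ↔ ∃ E ⊆ ℕ of natural density zero, ∀ n ≥ 1, n ∉ E → λ_n ≤ λ_{n+1}`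
— T-Li3 IN KERNEL, a RELABELLING of RH (RH-EQUIVALENT, PROVED; certifies nothing about RH; class (li, bridge) unchanged).

This file: §8 (ll. 1472–1749 of the scratch): `cLog`, `gK`, `integral_model_piece`, `integral_gK_split`, head/tail bounds, `tail_sub_tail`,
`abs_integral_gK_local_le`, `abs_tail_le'`.

Gate dedup: `log_two_pi_bounds` is `private` here (it restates the landed `LiTheory.Budget.log_two_pi_crude`); its one downstream use
(in `LiIncrHighPartModelB.lean`) cites the landed lemma instead.

HONEST LABEL: «SPLITTING SEARCH over kernel-typed RH-EQUIVALENCES; a splitting A ∧ B ⟹ RH is CONDITIONAL bookkeeping unless A and B are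
both proved; nothing here bears on the truth of RH.»
-/

set_option linter.dupNamespace false

noncomputable section

namespace Summit.RiemannHypothesis.RiemannHypothesis.Theorems.Splittings.LiIncrHighPart

open Filter Topology Finset Set MeasureTheory
open scoped Real
open Literature.NumberTheory.LFunctions Literature.NumberTheory.LFunctions.SchoenfeldBound
open Literature.NumberTheory.DiophantineGeometry
open Summit.RiemannHypothesis.RiemannHypothesis.Theorems.LiTheory
open Summit.RiemannHypothesis.RiemannHypothesis.Theorems.LiTheory.SmoothReplace
open Summit.RiemannHypothesis.RiemannHypothesis.Theorems.LiTheory.Window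

/-! ## §8 The model main term `½∫_Y^{T'} w̃_n log(t/2π)` via the substitution `u = k/t` (RH-free)

`∫_Y^{T'} (1 − cos(k/t)) log(t/2π) dt = k ∫_{k/T'}^{k/Y} g_k`, `g_k(u) = (1 − cos u)(c_k − log u)/u²`,
`c_k = log(k/2π)`; `∫_0^∞ g_k = (π/2)(c_k − 1 + γ)` (tree, `ModelIntegral.integral_substituted`), so that
`(k/π)∫_0^∞ g_k = liMainTerm k`; the pieces `∫_0^{k/T'} g_k` (head) and `∫_{k/Y}^∞ g_k` (tail) are small,
the tails of `k = n, n+1` CANCEL to first order (`g_{n+1} − g_n = log(1+1/n)(1 − cos u)/u²`). -/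

/-- `c_k := log(k/2π)`. -/
def cLog (k : ℝ) : ℝ := Real.log (k / (2 * π))

/-- `g_k(u) := (1 − cos u)(c_k − log u)/u²`. -/
def gK (k : ℝ) (u : ℝ) : ℝ := (1 - Real.cos u) * (cLog k - Real.log u) / u ^ 2

/-- Auxiliary lemma `log_two_pi_bounds` of the model main term [β] (li-bridge g6 `SketchG6T`; see the module docstring for its place in the argument). -/
private theorem log_two_pi_bounds : 0 ≤ Real.log (2 * π) ∧ Real.log (2 * π) ≤ 2 := by
  have hπ3 := Real.pi_gt_three
  have hπ4 := Real.pi_lt_d2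
  refine ⟨Real.log_nonneg (by linarith), ?_⟩
  have h : 2 * π ≤ Real.exp 2 := by
    have he := Real.exp_one_gt_d9
    have h2 : Real.exp 2 = Real.exp 1 * Real.exp 1 := by rw [← Real.exp_add]; norm_num
    have h7 : (2.7182818283 : ℝ) * 2.7182818283 < Real.exp 1 * Real.exp 1 :=
      mul_lt_mul'' he he (by norm_num) (by norm_num)
    rw [h2]; norm_num at h7 ⊢; linarith
  calc Real.log (2 * π) ≤ Real.log (Real.exp 2) := Real.log_le_log (by positivity) h
    _ = 2 := Real.log_exp 2

/-- `|c_k| ≤ log k + 2` for `k ≥ 1`. -/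
theorem abs_cLog_le {k : ℝ} (hk : 1 ≤ k) : |cLog k| ≤ Real.log k + 2 := by
  obtain ⟨h0, h2⟩ := log_two_pi_bounds
  have hk0 : 0 < k := by linarith
  have hlk : 0 ≤ Real.log k := Real.log_nonneg hk
  unfold cLog
  rw [Real.log_div hk0.ne' (by positivity), abs_le]
  constructor <;> linarith

/-- Auxiliary lemma `integrableOn_gK` of the model main term [β] (li-bridge g6 `SketchG6T`; see the module docstring for its place in the argument). -/
theorem integrableOn_gK (k : ℝ) : IntegrableOn (gK k) (Ioi 0) := by
  have h := (ModelIntegral.integrableOn_one_sub_cos_div_sq.const_mul (cLog k)).sub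
    ModelIntegral.integrableOn_one_sub_cos_mul_log_div_sq
  refine IntegrableOn.congr_fun h (fun u _ ↦ ?_) measurableSet_Ioi
  simp only [gK, Pi.sub_apply]
  ring

/-- Auxiliary lemma `integral_gK_Ioi` of the model main term [β] (li-bridge g6 `SketchG6T`; see the module docstring for its place in the argument). -/
theorem integral_gK_Ioi (k : ℝ) :
    ∫ u in Ioi 0, gK k u = π / 2 * (cLog k - 1 + Real.eulerMascheroniConstant) := by
  unfold gK cLog
  exact ModelIntegral.integral_substituted

/-- `(k/π) ∫_0^∞ g_k = liMainTerm k` (`k ≥ 1`). -/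
theorem mul_integral_gK_Ioi {k : ℕ} (hk : 1 ≤ k) :
    (k : ℝ) * ∫ u in Ioi 0, gK k u = π * liMainTerm k := by
  have hk0 : (0 : ℝ) < k := by exact_mod_cast hk
  have hπ := Real.pi_pos
  rw [integral_gK_Ioi, liMainTerm, liC1, cLog, Real.log_div hk0.ne' (by positivity)]
  ring

/-- Auxiliary lemma `continuousOn_gK` of the model main term [β] (li-bridge g6 `SketchG6T`; see the module docstring for its place in the argument). -/
theorem continuousOn_gK (k : ℝ) : ContinuousOn (gK k) (Ioi 0) := by
  refine continuousOn_of_forall_continuousAt fun u hu ↦ ?_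
  have hu0 : u ≠ 0 := (mem_Ioi.1 hu).ne'
  have hu2 : u ^ 2 ≠ 0 := pow_ne_zero 2 hu0
  unfold gK cLog
  fun_prop (disch := assumption)

/-- **The substitution `u = k/t`:** `∫_Y^{T'} (1 − cos(k/t)) log(t/2π) dt = k ∫_{k/T'}^{k/Y} g_k`
(`0 < k`, `0 < Y ≤ T'`). -/
theorem integral_model_piece {k : ℝ} (hk : 0 < k) {Y T' : ℝ} (hY : 0 < Y) (hYT : Y ≤ T') :
    ∫ t in Y..T', (1 - Real.cos (k / t)) * Real.log (t / (2 * π)) =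
      k * ∫ u in k / T'..k / Y, gK k u := by
  have hπ := Real.pi_pos
  have hderiv : ∀ t ∈ uIcc Y T', HasDerivAt (fun y : ℝ ↦ k / y) (-k / t ^ 2) t := by
    intro t ht
    rw [uIcc_of_le hYT] at ht
    have ht0 : t ≠ 0 := by linarith [ht.1]
    have h := (hasDerivAt_const t k).div (hasDerivAt_id t) ht0
    refine h.congr_deriv ?_
    simp only [id]
    field_simp
    ring
  have hcont : ContinuousOn (fun t : ℝ ↦ -k / t ^ 2) (uIcc Y T') := by
    refine continuousOn_of_forall_continuousAt fun t ht ↦ ?_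
    rw [uIcc_of_le hYT] at ht
    have ht0 : t ≠ 0 := by linarith [ht.1]
    have ht2 : t ^ 2 ≠ 0 := pow_ne_zero 2 ht0
    fun_prop (disch := assumption)
  have himg : (fun y : ℝ ↦ k / y) '' uIcc Y T' ⊆ Ioi 0 := by
    rintro _ ⟨t, ht, rfl⟩
    rw [uIcc_of_le hYT] at ht
    exact mem_Ioi.2 (div_pos hk (by linarith [ht.1]))
  have hsub := intervalIntegral.integral_comp_mul_deriv' hderiv hcont ((continuousOn_gK k).mono himg)
  have hpt : EqOn (fun t : ℝ ↦ (1 - Real.cos (k / t)) * Real.log (t / (2 * π)))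
      (fun t : ℝ ↦ -k * (((gK k) ∘ fun y : ℝ ↦ k / y) t * (-k / t ^ 2))) (uIcc Y T') := by
    intro t ht
    rw [uIcc_of_le hYT] at ht
    have ht0 : 0 < t := by linarith [ht.1]
    have hk0 : k ≠ 0 := hk.ne'
    have ht0' : t ≠ 0 := ht0.ne'
    simp only [Function.comp, gK, cLog]
    have hL : Real.log (k / (2 * π)) - Real.log (k / t) = Real.log (t / (2 * π)) := by
      rw [Real.log_div hk0 (by positivity), Real.log_div hk0 ht0', Real.log_div ht0' (by positivity)]
      ring
    rw [hL]
    field_simp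
  rw [intervalIntegral.integral_congr hpt, intervalIntegral.integral_const_mul, hsub,
    intervalIntegral.integral_symm]
  ring

/-- Splitting off head and tail: `∫_ε^U g_k = ∫_0^∞ g_k − ∫_0^ε g_k − ∫_U^∞ g_k` (`0 ≤ ε ≤ U`). -/
theorem integral_gK_split (k : ℝ) {ε U : ℝ} (hε : 0 ≤ ε) (hεU : ε ≤ U) :
    ∫ u in ε..U, gK k u =
      (∫ u in Ioi 0, gK k u) - (∫ u in (0 : ℝ)..ε, gK k u) - ∫ u in Ioi U, gK k u := by
  have h0 := intervalIntegral.integral_Ioi_sub_Ioi (integrableOn_gK k) hε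
  have h1 := intervalIntegral.integral_Ioi_sub_Ioi
    ((integrableOn_gK k).mono_set (Ioi_subset_Ioi hε)) hεU
  linarith

/-- Head: `|∫_0^ε g_k| ≤ (|c_k|/2) ε + 2√ε` for `0 < ε ≤ 1` (`(1 − cos u)/u² ≤ ½`, `−log u ≤ 2u^{-1/2}`). -/
theorem abs_head_le (k : ℝ) {ε : ℝ} (hε : 0 < ε) (hε1 : ε ≤ 1) :
    |∫ u in (0 : ℝ)..ε, gK k u| ≤ |cLog k| / 2 * ε + 2 * Real.sqrt ε := by
  have hle : ∀ᵐ u ∂volume, u ∈ Ioc 0 ε → ‖gK k u‖ ≤ |cLog k| / 2 + u ^ (-(1 / 2) : ℝ) :=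
    Filter.Eventually.of_forall fun u hu ↦ by
      have hu0 : 0 < u := hu.1
      have hu1 : u ≤ 1 := hu.2.trans hε1
      rw [Real.norm_eq_abs]
      unfold gK
      rw [abs_div, abs_mul, abs_of_nonneg (by linarith [Real.cos_le_one u] : 0 ≤ 1 - Real.cos u),
        abs_of_pos (pow_pos hu0 2)]
      have hc : 1 - Real.cos u ≤ u ^ 2 / 2 := by linarith [Real.one_sub_sq_div_two_le_cos (x := u)]
      have hlog : |Real.log u| ≤ 2 * u ^ (-(1 / 2) : ℝ) := by
        rw [abs_of_nonpos (Real.log_nonpos hu0.le hu1)]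
        have h := Real.log_le_rpow_div (x := u⁻¹) (by positivity) (by norm_num : (0 : ℝ) < 1 / 2)
        rw [Real.log_inv, Real.inv_rpow hu0.le, ← Real.rpow_neg hu0.le] at h
        have e : u ^ (-(1 / 2) : ℝ) / (1 / 2) = 2 * u ^ (-(1 / 2) : ℝ) := by ring
        linarith
      have h1 : |cLog k - Real.log u| ≤ |cLog k| + 2 * u ^ (-(1 / 2) : ℝ) :=
        (abs_sub _ _).trans (by linarith)
      have hpos : 0 ≤ u ^ (-(1 / 2) : ℝ) := Real.rpow_nonneg hu0.le _
      calc (1 - Real.cos u) * |cLog k - Real.log u| / u ^ 2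
          ≤ u ^ 2 / 2 * (|cLog k| + 2 * u ^ (-(1 / 2) : ℝ)) / u ^ 2 :=
            div_le_div_of_nonneg_right (mul_le_mul hc h1 (abs_nonneg _) (by positivity)) (by positivity)
        _ = |cLog k| / 2 + u ^ (-(1 / 2) : ℝ) := by field_simp
  have hint1 : IntervalIntegrable (fun _ : ℝ ↦ |cLog k| / 2) volume 0 ε := intervalIntegrable_const
  have hint2 : IntervalIntegrable (fun u : ℝ ↦ u ^ (-(1 / 2) : ℝ)) volume 0 ε :=
    intervalIntegral.intervalIntegrable_rpow' (by norm_num)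
  have h := intervalIntegral.norm_integral_le_of_norm_le hε.le hle (hint1.add hint2)
  rw [intervalIntegral.integral_add hint1 hint2, intervalIntegral.integral_const,
    integral_rpow (Or.inl (by norm_num)), Real.norm_eq_abs] at h
  have e1 : (-(1 / 2) : ℝ) + 1 = 1 / 2 := by norm_num
  rw [e1, Real.zero_rpow (by norm_num), ← Real.sqrt_eq_rpow] at h
  simp only [sub_zero, smul_eq_mul] at h
  have e2 : Real.sqrt ε / (1 / 2) = 2 * Real.sqrt ε := by ring
  rw [e2] at h
  linarith

/-- Tail: `|∫_U^∞ g_k| ≤ 2|c_k|/U + 8/√U` for `U ≥ 1`. -/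
theorem abs_tail_le (k : ℝ) {U : ℝ} (hU : 1 ≤ U) :
    |∫ u in Ioi U, gK k u| ≤ 2 * |cLog k| / U + 8 * U ^ (-(1 / 2) : ℝ) := by
  have hU0 : 0 < U := by linarith
  have hint1 : IntegrableOn (fun u : ℝ ↦ u ^ (-2 : ℝ)) (Ioi U) :=
    integrableOn_Ioi_rpow_of_lt (by norm_num) hU0
  have hint2 : IntegrableOn (fun u : ℝ ↦ u ^ (-(3 / 2) : ℝ)) (Ioi U) :=
    integrableOn_Ioi_rpow_of_lt (by norm_num) hU0
  have hG : IntegrableOn (fun u : ℝ ↦ 2 * |cLog k| * u ^ (-2 : ℝ) + 4 * u ^ (-(3 / 2) : ℝ)) (Ioi U) :=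
    (hint1.const_mul _).add (hint2.const_mul _)
  have hle : ∀ᵐ u ∂(volume.restrict (Ioi U)),
      ‖gK k u‖ ≤ 2 * |cLog k| * u ^ (-2 : ℝ) + 4 * u ^ (-(3 / 2) : ℝ) := by
    refine ae_restrict_of_forall_mem measurableSet_Ioi fun u hu ↦ ?_
    have hu1 : 1 ≤ u := hU.trans (mem_Ioi.1 hu).le
    have hu0 : 0 < u := by linarith
    rw [Real.norm_eq_abs]
    unfold gK
    rw [abs_div, abs_mul, abs_of_nonneg (by linarith [Real.cos_le_one u] : 0 ≤ 1 - Real.cos u),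
      abs_of_pos (pow_pos hu0 2)]
    have hc2 : 1 - Real.cos u ≤ 2 := by linarith [Real.neg_one_le_cos u]
    have hlog0 : 0 ≤ Real.log u := Real.log_nonneg hu1
    have hlog : Real.log u ≤ 2 * u ^ ((1 / 2) : ℝ) := by
      have h := Real.log_le_rpow_div hu0.le (by norm_num : (0 : ℝ) < 1 / 2)
      have e : u ^ ((1 / 2) : ℝ) / (1 / 2) = 2 * u ^ ((1 / 2) : ℝ) := by ring
      linarith
    have h1 : |cLog k - Real.log u| ≤ |cLog k| + 2 * u ^ ((1 / 2) : ℝ) :=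
      (abs_sub _ _).trans (by rw [abs_of_nonneg hlog0]; linarith)
    have e1 : u ^ (-2 : ℝ) = 1 / u ^ 2 := by
      rw [Real.rpow_neg hu0.le, show (2 : ℝ) = ((2 : ℕ) : ℝ) by norm_num, Real.rpow_natCast]
      simp
    have e2 : u ^ (-(3 / 2) : ℝ) = u ^ ((1 / 2) : ℝ) / u ^ 2 := by
      rw [Real.rpow_neg hu0.le, show (3 / 2 : ℝ) = 2 - 1 / 2 by norm_num, Real.rpow_sub hu0,
        show (2 : ℝ) = ((2 : ℕ) : ℝ) by norm_num, Real.rpow_natCast]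
      field_simp
    rw [e1, e2]
    have hpos : 0 ≤ u ^ ((1 / 2) : ℝ) := Real.rpow_nonneg hu0.le _
    calc (1 - Real.cos u) * |cLog k - Real.log u| / u ^ 2
        ≤ 2 * (|cLog k| + 2 * u ^ ((1 / 2) : ℝ)) / u ^ 2 :=
          div_le_div_of_nonneg_right (mul_le_mul hc2 h1 (abs_nonneg _) (by norm_num)) (by positivity)
      _ = 2 * |cLog k| * (1 / u ^ 2) + 4 * (u ^ ((1 / 2) : ℝ) / u ^ 2) := by ring
  have h := norm_integral_le_of_norm_le hG hle
  rw [Real.norm_eq_abs, integral_add (hint1.const_mul _) (hint2.const_mul _), integral_const_mul,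
    integral_const_mul, integral_Ioi_rpow_of_lt (by norm_num) hU0,
    integral_Ioi_rpow_of_lt (by norm_num) hU0] at h
  have e3 : -U ^ ((-2 : ℝ) + 1) / ((-2 : ℝ) + 1) = 1 / U := by
    rw [show (-2 : ℝ) + 1 = -1 by norm_num, Real.rpow_neg_one]
    field_simp
  have e4 : -U ^ ((-(3 / 2) : ℝ) + 1) / ((-(3 / 2) : ℝ) + 1) = 2 * U ^ (-(1 / 2) : ℝ) := by
    rw [show (-(3 / 2) : ℝ) + 1 = -(1 / 2) by norm_num]
    ring
  rw [e3, e4] at h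
  calc |∫ u in Ioi U, gK k u| ≤ 2 * |cLog k| * (1 / U) + 4 * (2 * U ^ (-(1 / 2) : ℝ)) := h
    _ = 2 * |cLog k| / U + 8 * U ^ (-(1 / 2) : ℝ) := by ring

/-- Difference of tails at the same `U`: `∫_U^∞ (g_{k'} − g_k) = (c_{k'} − c_k) ∫_U^∞ (1 − cos u)/u²`. -/
theorem tail_sub_tail (k k' : ℝ) {U : ℝ} (hU : 0 < U) :
    (∫ u in Ioi U, gK k' u) - (∫ u in Ioi U, gK k u) =
      (cLog k' - cLog k) * ∫ u in Ioi U, (1 - Real.cos u) / u ^ 2 := by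
  rw [← integral_sub ((integrableOn_gK k').mono_set (Ioi_subset_Ioi hU.le))
    ((integrableOn_gK k).mono_set (Ioi_subset_Ioi hU.le)), ← integral_const_mul]
  refine setIntegral_congr_fun measurableSet_Ioi fun u _ ↦ ?_
  simp only [gK]
  ring

/-- `0 ≤ ∫_U^∞ (1 − cos u)/u² ≤ 2/U` (`U > 0`). -/
theorem integral_one_sub_cos_tail_bounds {U : ℝ} (hU : 0 < U) :
    0 ≤ ∫ u in Ioi U, (1 - Real.cos u) / u ^ 2 ∧ ∫ u in Ioi U, (1 - Real.cos u) / u ^ 2 ≤ 2 / U := by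
  have hint1 : IntegrableOn (fun u : ℝ ↦ u ^ (-2 : ℝ)) (Ioi U) :=
    integrableOn_Ioi_rpow_of_lt (by norm_num) hU
  constructor
  · exact setIntegral_nonneg measurableSet_Ioi fun u hu ↦
      div_nonneg (by linarith [Real.cos_le_one u]) (sq_nonneg u)
  · have hle : ∀ᵐ u ∂(volume.restrict (Ioi U)), ‖(1 - Real.cos u) / u ^ 2‖ ≤ 2 * u ^ (-2 : ℝ) := by
      refine ae_restrict_of_forall_mem measurableSet_Ioi fun u hu ↦ ?_
      have hu0 : 0 < u := hU.trans (mem_Ioi.1 hu)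
      rw [Real.norm_eq_abs, abs_div, abs_of_nonneg (by linarith [Real.cos_le_one u] : 0 ≤ 1 - Real.cos u),
        abs_of_pos (pow_pos hu0 2)]
      have e1 : u ^ (-2 : ℝ) = 1 / u ^ 2 := by
        rw [Real.rpow_neg hu0.le, show (2 : ℝ) = ((2 : ℕ) : ℝ) by norm_num, Real.rpow_natCast]
        simp
      rw [e1, div_eq_mul_one_div]
      exact mul_le_mul_of_nonneg_right (by linarith [Real.neg_one_le_cos u]) (by positivity)
    have h := norm_integral_le_of_norm_le (hint1.const_mul 2) hle
    rw [Real.norm_eq_abs, integral_const_mul, integral_Ioi_rpow_of_lt (by norm_num) hU,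
      show (-2 : ℝ) + 1 = -1 by norm_num, Real.rpow_neg_one] at h
    have e : (2 : ℝ) * (-U⁻¹ / -1) = 2 / U := by field_simp
    rw [e] at h
    exact (le_abs_self _).trans h

/-- The local piece: `|∫_{U₀}^{U₁} g_k| ≤ (U₁ − U₀) · 2(|c_k| + log U₁)/U₀²` for `1 ≤ U₀ ≤ U₁`. -/
theorem abs_integral_gK_local_le (k : ℝ) {U₀ U₁ : ℝ} (hU : 1 ≤ U₀) (hUU : U₀ ≤ U₁) :
    |∫ u in U₀..U₁, gK k u| ≤ (U₁ - U₀) * (2 * (|cLog k| + Real.log U₁) / U₀ ^ 2) := by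
  have hU0 : 0 < U₀ := by linarith
  have hb : ∀ u ∈ Set.uIoc U₀ U₁, ‖gK k u‖ ≤ 2 * (|cLog k| + Real.log U₁) / U₀ ^ 2 := by
    intro u hu
    rw [uIoc_of_le hUU] at hu
    have hu1 : 1 ≤ u := by linarith [hu.1]
    have hu0 : 0 < u := by linarith
    rw [Real.norm_eq_abs]
    unfold gK
    rw [abs_div, abs_mul, abs_of_nonneg (by linarith [Real.cos_le_one u] : 0 ≤ 1 - Real.cos u),
      abs_of_pos (pow_pos hu0 2)]
    have hc2 : 1 - Real.cos u ≤ 2 := by linarith [Real.neg_one_le_cos u]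
    have hlog0 : 0 ≤ Real.log u := Real.log_nonneg hu1
    have hlogle : Real.log u ≤ Real.log U₁ := Real.log_le_log hu0 hu.2
    have h1 : |cLog k - Real.log u| ≤ |cLog k| + Real.log U₁ :=
      (abs_sub _ _).trans (by rw [abs_of_nonneg hlog0]; linarith)
    have hsq : U₀ ^ 2 ≤ u ^ 2 := by nlinarith [hu.1]
    calc (1 - Real.cos u) * |cLog k - Real.log u| / u ^ 2
        ≤ 2 * (|cLog k| + Real.log U₁) / u ^ 2 :=
          div_le_div_of_nonneg_right (mul_le_mul hc2 h1 (abs_nonneg _) (by norm_num)) (by positivity)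
      _ ≤ 2 * (|cLog k| + Real.log U₁) / U₀ ^ 2 := by
          apply div_le_div_of_nonneg_left _ (by positivity) hsq
          have := Real.log_nonneg (hU.trans hUU); positivity
  have h := intervalIntegral.norm_integral_le_of_norm_le_const hb
  rw [Real.norm_eq_abs, abs_of_nonneg (by linarith : 0 ≤ U₁ - U₀)] at h
  linarith

/-- Tail bound with `√`: `|∫_U^∞ g_k| ≤ 2|c_k|/U + 8/√U` (`U ≥ 1`). -/
theorem abs_tail_le' (k : ℝ) {U : ℝ} (hU : 1 ≤ U) :
    |∫ u in Ioi U, gK k u| ≤ 2 * |cLog k| / U + 8 / Real.sqrt U := by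
  have h := abs_tail_le k hU
  have hU0 : 0 < U := by linarith
  rw [Real.rpow_neg hU0.le, ← Real.sqrt_eq_rpow] at h
  simpa [div_eq_mul_inv] using h

end Summit.RiemannHypothesis.RiemannHypothesis.Theorems.Splittings.LiIncrHighPart

end
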